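import Summits.QuantumFields.YangMills.Theses.ComplexCouplingChannel

/-!
# Strategist sketch — crux `TubeZeroFreeChannel` (stmt-QuantumFields-18841)

Typed census material (planner-cstrat-stmt-QuantumFields-18841-b1-0, 2026-08-17):

* `Zc`, `UniformZeroFreeOn`, `IsChannel`, `CruxBody`, `tubeZeroFreeChannel_iff` — the crux over
  named definitions (`Iff.rfl`).
* DECOMPOSITION: `CrossoverBridge`, `WeakCouplingCorridor`,
  `tubeZeroFreeChannel_of_split : CrossoverBridge → WeakCouplingCorridor → TubeZeroFreeChannel`
  (sorry-free glue: union of two channels through a common real point).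
* NEGATION: `SealedWall` and
  `not_tubeZeroFreeChannel_of_sealedWall : SealedWall G r → ¬ TubeZeroFreeChannel` (sorry-free).
-/

set_option autoImplicit false

noncomputable section

namespace Summit.QuantumFields.YangMills.Cruxes.TubeZeroFreeChannel.Strategist

open scoped BigOperators
open MeasureTheory
open Literature.MathematicalPhysics.QuantumFieldTheory (LatticeRep IsCompactSimpleLieGroup
  haarProbability)
open Summit.QuantumFields.YangMills.Theses.ComplexCouplingChannel (TubeZeroFreeChannel)

section Defs

variable (G : Type) [Group G] [TopologicalSpace G] [IsTopologicalGroup G] [CompactSpace G]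
  [MeasurableSpace G] [BorelSpace G]

/-- The complex-coupling Wilson partition function of the periodic box `a³ × t` in the
representation `r` — verbatim the `let Zc` of the route decl `TubeZeroFreeChannel`. -/
def Zc (r : LatticeRep G) (z : ℂ) (a t : ℕ) : ℂ :=
  let St := Fin a × Fin a × Fin a × Fin t
  let sh : St → Fin 4 → St := fun x μ => ![(finRotate a x.1, x.2.1, x.2.2.1, x.2.2.2),
    (x.1, finRotate a x.2.1, x.2.2.1, x.2.2.2), (x.1, x.2.1, finRotate a x.2.2.1, x.2.2.2),
    (x.1, x.2.1, x.2.2.1, finRotate t x.2.2.2)] μ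
  let pl : (St × Fin 4 → G) → St → Fin 4 → Fin 4 → G := fun U x μ ν =>
    U (x, μ) * U (sh x μ, ν) * (U (sh x ν, μ))⁻¹ * (U (x, ν))⁻¹
  ∫ U, Complex.exp (-(z * ((∑ x : St, ∑ q : {q : Fin 4 × Fin 4 // q.1 < q.2},
    ((r.N : ℝ) - (r.ρ (pl U x q.1.1 q.1.2)).trace.re) : ℝ) : ℂ)))
    ∂(Measure.pi fun _ : St × Fin 4 => haarProbability G)

/-- Uniform tube zero-freeness on `D`: a cross-section floor `L₀` and, for each `L ≥ L₀`, a length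
floor `t₀(L)` beyond which no tube partition function vanishes anywhere on `D`. -/
def UniformZeroFreeOn (r : LatticeRep G) (D : Set ℂ) : Prop :=
  ∃ L₀ : ℕ, ∀ L : ℕ, L₀ ≤ L → ∃ t₀ : ℕ, ∀ t : ℕ, t₀ ≤ t → ∀ z ∈ D, Zc G r z L t ≠ 0

/-- `D` is an anchor-connected uniformly zero-free channel to `β` at tolerance `ρ`. -/
def IsChannel (r : LatticeRep G) (β ρ : ℝ) (D : Set ℂ) : Prop :=
  IsOpen D ∧ IsConnected D ∧ (β : ℂ) ∈ D ∧ (∃ x : ℝ, |x| < ρ ∧ (x : ℂ) ∈ D) ∧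
    UniformZeroFreeOn G r D

/-- NEGATION — the typed obstruction.  A SEALED WALL for `(G, r)`: an open region `R ⊂ ℂ` that
contains every large real coupling, whose closure misses every small real coupling, and every
frontier point of which is a cofinal (in `L`, then in `t`) accumulation point of tube zeros. -/
def SealedWall (r : LatticeRep G) : Prop :=
  ∃ R : Set ℂ, IsOpen R ∧ (∃ b : ℝ, ∀ β : ℝ, b ≤ β → (β : ℂ) ∈ R) ∧
    (∃ ρ : ℝ, 0 < ρ ∧ ∀ x : ℝ, |x| < ρ → (x : ℂ) ∉ closure R) ∧
    ∀ w ∈ frontier R, ∀ ε : ℝ, 0 < ε → ∀ L₀ : ℕ, ∃ L : ℕ, L₀ ≤ L ∧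
      ∀ t₀ : ℕ, ∃ t : ℕ, t₀ ≤ t ∧ ∃ z : ℂ, dist z w < ε ∧ Zc G r z L t = 0

variable {G}

/-- Uniform zero-freeness is stable under binary unions (max of the floors). -/
theorem uniformZeroFreeOn_union (r : LatticeRep G) {D₁ D₂ : Set ℂ}
    (h₁ : UniformZeroFreeOn G r D₁) (h₂ : UniformZeroFreeOn G r D₂) :
    UniformZeroFreeOn G r (D₁ ∪ D₂) := by
  obtain ⟨L₁, hL₁⟩ := h₁
  obtain ⟨L₂, hL₂⟩ := h₂
  refine ⟨max L₁ L₂, fun L hL => ?_⟩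
  obtain ⟨t₁, ht₁⟩ := hL₁ L (le_of_max_le_left hL)
  obtain ⟨t₂, ht₂⟩ := hL₂ L (le_of_max_le_right hL)
  refine ⟨max t₁ t₂, fun t ht z hz => ?_⟩
  rcases hz with hz | hz
  · exact ht₁ t (le_of_max_le_left ht) z hz
  · exact ht₂ t (le_of_max_le_right ht) z hz

/-- Uniform zero-freeness passes to subsets. -/
theorem uniformZeroFreeOn_mono (r : LatticeRep G) {D₁ D₂ : Set ℂ} (h : D₁ ⊆ D₂)
    (h₂ : UniformZeroFreeOn G r D₂) : UniformZeroFreeOn G r D₁ := by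
  obtain ⟨L₀, hL₀⟩ := h₂
  refine ⟨L₀, fun L hL => ?_⟩
  obtain ⟨t₀, ht₀⟩ := hL₀ L hL
  exact ⟨t₀, fun t ht z hz => ht₀ t ht z (h hz)⟩

end Defs

/-- The crux over the named definitions. -/
def CruxBody : Prop :=
  ∀ (G : Type) [Group G] [TopologicalSpace G] [IsTopologicalGroup G] [CompactSpace G]
    [MeasurableSpace G] [BorelSpace G], IsCompactSimpleLieGroup G → ∀ r : LatticeRep G,
    ∃ β₁ : ℝ, ∀ β : ℝ, β₁ ≤ β → ∀ ρ : ℝ, 0 < ρ → ∃ D : Set ℂ, IsChannel G r β ρ D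

/-- The route decl IS `CruxBody`, definitionally. -/
theorem tubeZeroFreeChannel_iff : TubeZeroFreeChannel ↔ CruxBody := Iff.rfl

/-! ## DECOMPOSITION — bridge ⊕ corridor (glue proved; NOT filed, see STRATEGY-CENSUS.md) -/

/-- Sub₁ `CrossoverBridge`: the anchor-connected uniformly zero-free region reaches arbitrarily
large real couplings at SOME points (false for `U(1)`; finite coupling range; carries the
non-abelian content and the complex detours around on-axis first-order walls). -/
def CrossoverBridge : Prop :=
  ∀ (G : Type) [Group G] [TopologicalSpace G] [IsTopologicalGroup G] [CompactSpace G]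
    [MeasurableSpace G] [BorelSpace G], IsCompactSimpleLieGroup G → ∀ r : LatticeRep G,
    ∀ b : ℝ, ∀ ρ : ℝ, 0 < ρ → ∃ β : ℝ, b ≤ β ∧ ∃ D : Set ℂ, IsChannel G r β ρ D

/-- Sub₂ `WeakCouplingCorridor`: beyond some `β_c(G, r)` any two real couplings are joined by an
open connected uniformly zero-free set (no wall meets the weak-coupling axis; the asymptotic-freedom
piece, `U(1)`-true in kind). -/
def WeakCouplingCorridor : Prop :=
  ∀ (G : Type) [Group G] [TopologicalSpace G] [IsTopologicalGroup G] [CompactSpace G]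
    [MeasurableSpace G] [BorelSpace G], IsCompactSimpleLieGroup G → ∀ r : LatticeRep G,
    ∃ βc : ℝ, ∀ b β : ℝ, βc ≤ b → βc ≤ β → ∃ D : Set ℂ, IsOpen D ∧ IsConnected D ∧
      (b : ℂ) ∈ D ∧ (β : ℂ) ∈ D ∧ UniformZeroFreeOn G r D

/-- The split glue (sorry-free): bridge to some `b ≥ β_c`, then the corridor from `b` to `β`; the
union of two open connected uniformly zero-free sets through the common real point `b` is a
channel. -/
theorem tubeZeroFreeChannel_of_split :
    CrossoverBridge → WeakCouplingCorridor → TubeZeroFreeChannel := by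
  intro hB hC
  rw [tubeZeroFreeChannel_iff]
  intro G _ _ _ _ _ _ hG r
  obtain ⟨βc, hc⟩ := hC G hG r
  refine ⟨βc, fun β hβ ρ hρ => ?_⟩
  obtain ⟨b, hb, D₁, ho₁, hc₁, hb₁, ⟨x, hx, hxD⟩, hz₁⟩ := hB G hG r βc ρ hρ
  obtain ⟨D₂, ho₂, hc₂, hb₂, hβ₂, hz₂⟩ := hc b β hb hβ
  exact ⟨D₁ ∪ D₂, ho₁.union ho₂, IsConnected.union ⟨(b : ℂ), hb₁, hb₂⟩ hc₁ hc₂, Or.inr hβ₂,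
    ⟨x, hx, Or.inl hxD⟩, uniformZeroFreeOn_union r hz₁ hz₂⟩

/-! ## NEGATION — a sealed wall refutes the crux (glue proved) -/

/-- If some admissible `(G, r)` has a sealed wall, the crux is false: any open connected `D`
containing a large real `β ∈ R` and a small real `x ∉ closure R` meets `frontier R`
(`IsPreconnected.subset_of_closure_inter_subset`), hence contains a small ball around an
accumulation point of tube zeros. -/
theorem not_tubeZeroFreeChannel_of_sealedWall (G : Type) [Group G] [TopologicalSpace G]
    [IsTopologicalGroup G] [CompactSpace G] [MeasurableSpace G] [BorelSpace G]
    (hG : IsCompactSimpleLieGroup G) (r : LatticeRep G) (h : SealedWall G r) :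
    ¬ TubeZeroFreeChannel := by
  intro hT
  rw [tubeZeroFreeChannel_iff] at hT
  obtain ⟨R, hRo, ⟨b, hb⟩, ⟨ρ, hρ, hx⟩, hW⟩ := h
  obtain ⟨β₁, hβ₁⟩ := hT G hG r
  obtain ⟨D, hDo, hDc, hβD, ⟨x, hxρ, hxD⟩, L₀, hL⟩ := hβ₁ (max β₁ b) (le_max_left _ _) ρ hρ
  have hβR : ((max β₁ b : ℝ) : ℂ) ∈ R := hb _ (le_max_right _ _)
  have hnot : ¬ (closure R ∩ D ⊆ R) := fun hsub =>
    hx x hxρ (subset_closure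
      (hDc.isPreconnected.subset_of_closure_inter_subset hRo ⟨_, hβD, hβR⟩ hsub hxD))
  obtain ⟨w, ⟨hwc, hwD⟩, hwR⟩ := Set.not_subset.mp hnot
  have hwf : w ∈ frontier R := ⟨hwc, by rwa [hRo.interior_eq]⟩
  obtain ⟨ε, hε, hball⟩ := Metric.isOpen_iff.mp hDo w hwD
  obtain ⟨L, hL₀L, hLt⟩ := hW w hwf ε hε L₀
  obtain ⟨t₀, ht₀⟩ := hL L hL₀L
  obtain ⟨t, ht₀t, z, hz, hZ⟩ := hLt t₀
  exact ht₀ t ht₀t z (hball (Metric.mem_ball.mpr hz)) hZ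

/-! ## TRANSFER — the fixed-cross-section sibling (provable; NOT the crux) -/

/-- For each cross-section `L` SEPARATELY a zero-free open connected neighbourhood of the real
segment `[0, β]` exists for all large `t` (Perron–Frobenius–Jentzsch for the positivity-improving
transfer operator at real coupling, upper semicontinuity of the spectrum, compactness of the
segment).  The crux differs from this provable sibling EXACTLY by putting `∃ D` before
`∀ L ≥ L₀`; the transferred argument breaks at the extensive size `‖T_L(β+iy) − T_L(β)‖ ~ |y| L³`
against an `O(1)` spectral gap (perturbation radius `~ m_L(β)/L³ → 0`). -/
def TubeZeroFreePerL : Prop :=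
  ∀ (G : Type) [Group G] [TopologicalSpace G] [IsTopologicalGroup G] [CompactSpace G]
    [MeasurableSpace G] [BorelSpace G], IsCompactSimpleLieGroup G → ∀ r : LatticeRep G,
    ∀ β : ℝ, 0 ≤ β → ∀ L : ℕ, ∃ D : Set ℂ, IsOpen D ∧ IsConnected D ∧
      (∀ s : ℝ, 0 ≤ s → s ≤ β → (s : ℂ) ∈ D) ∧ ∃ t₀ : ℕ, ∀ t : ℕ, t₀ ≤ t → ∀ z ∈ D, Zc G r z L t ≠ 0

/-! ## STRENGTHEN — the strip corridor S⁺ (implies the crux; FALSE for van Enter–Shlosman reps) -/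

/-- S⁺ `StripCorridor`: a whole `δ`-strip about the real segment `[0, β]` is uniformly zero-free. -/
def StripCorridor : Prop :=
  ∀ (G : Type) [Group G] [TopologicalSpace G] [IsTopologicalGroup G] [CompactSpace G]
    [MeasurableSpace G] [BorelSpace G], IsCompactSimpleLieGroup G → ∀ r : LatticeRep G,
    ∃ β₁ : ℝ, ∀ β : ℝ, β₁ ≤ β → ∃ δ : ℝ, 0 < δ ∧
      UniformZeroFreeOn G r {z : ℂ | -δ < z.re ∧ z.re < β + δ ∧ -δ < z.im ∧ z.im < δ}

section Strip

variable {G : Type} [Group G] [TopologicalSpace G] [IsTopologicalGroup G] [CompactSpace G]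
  [MeasurableSpace G] [BorelSpace G]

/-- The open strip is open. -/
theorem isOpen_strip (β δ : ℝ) :
    IsOpen {z : ℂ | -δ < z.re ∧ z.re < β + δ ∧ -δ < z.im ∧ z.im < δ} :=
  (isOpen_lt continuous_const Complex.continuous_re).inter
    ((isOpen_lt Complex.continuous_re continuous_const).inter
      ((isOpen_lt continuous_const Complex.continuous_im).inter
        (isOpen_lt Complex.continuous_im continuous_const)))

/-- The open strip is convex. -/
theorem convex_strip (β δ : ℝ) :
    Convex ℝ {z : ℂ | -δ < z.re ∧ z.re < β + δ ∧ -δ < z.im ∧ z.im < δ} :=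
  (convex_halfSpace_re_gt (-δ)).inter ((convex_halfSpace_re_lt (β + δ)).inter
    ((convex_halfSpace_im_gt (-δ)).inter (convex_halfSpace_im_lt δ)))

/-- `AxisBlocked G r`: some real coupling `z_t > 0` admits NO uniformly zero-free complex
neighbourhood (for the van Enter–Shlosman representations `r_p = (2N·𝟙 ⊕ V ⊕ V̄)^{⊗p}`, `p ≫ 1`,
this follows from their Theorem 2 — a first-order bulk transition at a real `z_t(p)` — by the
Vitali/Harnack argument "uniformly zero-free near `z_t` ⇒ free energy analytic at `z_t`";
recorded, not proved here). -/
def AxisBlocked (r : LatticeRep G) : Prop :=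
  ∃ zt : ℝ, 0 < zt ∧ ∀ δ : ℝ, 0 < δ → ¬ UniformZeroFreeOn G r (Metric.ball (zt : ℂ) δ)

/-- An axis-blocked admissible `(G, r)` refutes the strip corridor S⁺ (sorry-free). -/
theorem not_stripCorridor_of_axisBlocked (hG : IsCompactSimpleLieGroup G) (r : LatticeRep G)
    (h : AxisBlocked (G := G) r) : ¬ StripCorridor := by
  intro hS
  obtain ⟨zt, hzt, hblk⟩ := h
  obtain ⟨β₁, hβ₁⟩ := hS G hG r
  obtain ⟨δ, hδ, hz⟩ := hβ₁ (max β₁ zt) (le_max_left _ _)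
  refine hblk δ hδ (uniformZeroFreeOn_mono r ?_ hz)
  intro z hzball
  have hn : ‖z - (zt : ℂ)‖ < δ := by simpa [dist_eq_norm] using hzball
  have hre : |z.re - zt| < δ := by
    have := Complex.abs_re_le_norm (z - (zt : ℂ))
    simp only [Complex.sub_re, Complex.ofReal_re] at this
    exact lt_of_le_of_lt this hn
  have him : |z.im| < δ := by
    have := Complex.abs_im_le_norm (z - (zt : ℂ))
    simp only [Complex.sub_im, Complex.ofReal_im, sub_zero] at this
    exact lt_of_le_of_lt this hn
  have hzt' : zt ≤ max β₁ zt := le_max_right _ _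
  refine ⟨?_, ?_, ?_, ?_⟩
  · linarith [(abs_lt.mp hre).1]
  · linarith [(abs_lt.mp hre).2]
  · exact (abs_lt.mp him).1
  · exact (abs_lt.mp him).2

end Strip

/-- S⁺ ⇒ crux (sorry-free): the strip itself is the channel (open, convex hence connected, contains
`β` and the anchor point `0`). -/
theorem tubeZeroFreeChannel_of_strip : StripCorridor → TubeZeroFreeChannel := by
  intro hS
  rw [tubeZeroFreeChannel_iff]
  intro G _ _ _ _ _ _ hG r
  obtain ⟨β₁, hβ₁⟩ := hS G hG r
  refine ⟨max β₁ 0, fun β hβ ρ hρ => ?_⟩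
  have hβ0 : 0 ≤ β := le_trans (le_max_right _ _) hβ
  obtain ⟨δ, hδ, hz⟩ := hβ₁ β (le_trans (le_max_left _ _) hβ)
  have hβmem : (β : ℂ) ∈ {z : ℂ | -δ < z.re ∧ z.re < β + δ ∧ -δ < z.im ∧ z.im < δ} := by
    refine ⟨?_, ?_, ?_, ?_⟩ <;> simp <;> linarith
  have h0mem : ((0 : ℝ) : ℂ) ∈ {z : ℂ | -δ < z.re ∧ z.re < β + δ ∧ -δ < z.im ∧ z.im < δ} := by
    refine ⟨?_, ?_, ?_, ?_⟩ <;> simp <;> linarith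
  exact ⟨_, isOpen_strip β δ, (convex_strip β δ).isConnected ⟨_, hβmem⟩, hβmem,
    ⟨0, by simpa using hρ, h0mem⟩, hz⟩

/-! ## TECHNIQUE WITH TEETH — finite-size mixing ⇒ uniform complex zero-freeness.
Its first (analytic) lemma `CumulantDisc`, its circular input `WeakCouplingCumulantBounds`, and the
corridor glue (proved).  NOT registered as a line: see STRATEGY-CENSUS.md §Transfer. -/

/-- First lemma of the technique (pure complex analysis, provable, size M): uniform Taylor
(cumulant) bounds `|∂ⁿ log Z(·; L, t)(β₀)| ≤ V · n! · Cⁿ` at a REAL coupling give a zero-free disc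
of radius `1/C` about `β₀` — the radius of convergence of the Taylor series of `log Z` at `β₀` is
`≥ 1/C`, and a zero of the entire function `Z` inside that disc would cap it. -/
def CumulantDisc : Prop :=
  ∀ (G : Type) [Group G] [TopologicalSpace G] [IsTopologicalGroup G] [CompactSpace G]
    [MeasurableSpace G] [BorelSpace G], IsCompactSimpleLieGroup G → ∀ r : LatticeRep G,
    ∀ β₀ C : ℝ, 0 < C → ∀ L t : ℕ,
      (∀ n : ℕ, 1 ≤ n → |iteratedDeriv n (fun s : ℝ => Real.log ‖Zc G r (s : ℂ) L t‖) β₀| ≤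
        ((L : ℝ) ^ 3 * t) * n.factorial * C ^ n) →
      ∀ z : ℂ, dist z (β₀ : ℂ) < C⁻¹ → Zc G r z L t ≠ 0

/-- The technique's INPUT, typed: uniform cumulant bounds of the tube free energies along the whole
weak-coupling axis (what a finite-size strong-mixing condition at real `β` delivers through the
Olivieri–Picco block cluster expansion / Dobrushin–Shlosman complete analyticity).  On THIS route it
is circular: it contains the volume-uniform weak-coupling lattice gap that the route wants to DERIVE
from the crux by harmonic measure. -/
def WeakCouplingCumulantBounds : Prop :=
  ∀ (G : Type) [Group G] [TopologicalSpace G] [IsTopologicalGroup G] [CompactSpace G]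
    [MeasurableSpace G] [BorelSpace G], IsCompactSimpleLieGroup G → ∀ r : LatticeRep G,
    ∃ βc : ℝ, ∀ B : ℝ, βc ≤ B → ∃ C : ℝ, 0 < C ∧ ∃ L₀ : ℕ, ∀ L : ℕ, L₀ ≤ L → ∃ t₀ : ℕ,
      ∀ t : ℕ, t₀ ≤ t → ∀ β₀ : ℝ, βc ≤ β₀ → β₀ ≤ B → ∀ n : ℕ, 1 ≤ n →
        |iteratedDeriv n (fun s : ℝ => Real.log ‖Zc G r (s : ℂ) L t‖) β₀| ≤
          ((L : ℝ) ^ 3 * t) * n.factorial * C ^ n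

/-- Corridor glue (sorry-free): discs of the uniform radius `1/C` centred on `[min b β, max b β]`
cover the open rectangle of half-height `1/(2C)` about that segment, which is the corridor. -/
theorem weakCouplingCorridor_of_cumulants :
    CumulantDisc → WeakCouplingCumulantBounds → WeakCouplingCorridor := by
  intro hD hB G _ _ _ _ _ _ hG r
  obtain ⟨βc, hβc⟩ := hB G hG r
  refine ⟨βc, fun b β hb hβ => ?_⟩
  obtain ⟨C, hC, L₀, hL⟩ := hβc (max b β) (le_trans hb (le_max_left _ _))
  have hCi : 0 < C⁻¹ := inv_pos.mpr hC
  set lo := min b β with hlo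
  set hi := max b β with hhi
  set η : ℝ := C⁻¹ / 2 with hη
  have hη0 : 0 < η := by positivity
  let D : Set ℂ := {z : ℂ | -η < z.re - lo ∧ z.re < hi + η ∧ -η < z.im ∧ z.im < η}
  have hDo : IsOpen D :=
    (isOpen_lt continuous_const (Complex.continuous_re.sub continuous_const)).inter
      ((isOpen_lt Complex.continuous_re continuous_const).inter
        ((isOpen_lt continuous_const Complex.continuous_im).inter
          (isOpen_lt Complex.continuous_im continuous_const)))
  have hDconv : Convex ℝ D := by
    have h1 : Convex ℝ {z : ℂ | -η < z.re - lo} := by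
      have : {z : ℂ | -η < z.re - lo} = {z : ℂ | lo - η < z.re} := by
        ext z; simp only [Set.mem_setOf_eq]; constructor <;> intro h <;> linarith
      rw [this]; exact convex_halfSpace_re_gt _
    exact h1.inter ((convex_halfSpace_re_lt (hi + η)).inter
      ((convex_halfSpace_im_gt (-η)).inter (convex_halfSpace_im_lt η)))
  have hmem : ∀ s : ℝ, lo ≤ s → s ≤ hi → (s : ℂ) ∈ D := fun s h1 h2 => by
    refine ⟨?_, ?_, ?_, ?_⟩ <;> simp <;> linarith
  have hbD : (b : ℂ) ∈ D := hmem b (min_le_left _ _) (le_max_left _ _)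
  have hβD : (β : ℂ) ∈ D := hmem β (min_le_right _ _) (le_max_right _ _)
  refine ⟨D, hDo, hDconv.isConnected ⟨_, hbD⟩, hbD, hβD, L₀, fun L hLL => ?_⟩
  obtain ⟨t₀, ht⟩ := hL L hLL
  refine ⟨t₀, fun t htt z hz => ?_⟩
  obtain ⟨h1, h2, h3, h4⟩ := hz
  -- clamp `re z` to the segment `[lo, hi]`
  set s : ℝ := max lo (min z.re hi) with hs
  have hlohi : lo ≤ hi := le_trans (min_le_left _ _) (le_max_left _ _)
  have hs1 : lo ≤ s := le_max_left _ _
  have hs2 : s ≤ hi := max_le hlohi (min_le_right _ _)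
  have hsc : βc ≤ s := le_trans (le_min hb hβ) hs1
  have hres : |z.re - s| ≤ η := by
    rw [abs_le]
    constructor
    · -- -η ≤ re z - s
      rcases le_total z.re hi with hzh | hzh
      · have : s = max lo z.re := by rw [hs, min_eq_left hzh]
        rcases le_total lo z.re with hlz | hlz
        · rw [this, max_eq_right hlz]; linarith
        · rw [this, max_eq_left hlz]; linarith
      · have : s = hi := by
          rw [hs, min_eq_right hzh, max_eq_right hlohi]
        rw [this]; linarith
    · rcases le_total z.re hi with hzh | hzh
      · have : s = max lo z.re := by rw [hs, min_eq_left hzh]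
        rw [this]
        have := le_max_right lo z.re
        linarith
      · have : s = hi := by
          rw [hs, min_eq_right hzh, max_eq_right hlohi]
        rw [this]; linarith
  have hdist : dist z (s : ℂ) < C⁻¹ := by
    rw [dist_eq_norm]
    have hn := Complex.norm_le_abs_re_add_abs_im (z - (s : ℂ))
    simp only [Complex.sub_re, Complex.ofReal_re, Complex.sub_im, Complex.ofReal_im,
      sub_zero] at hn
    have him : |z.im| < η := abs_lt.mpr ⟨h3, h4⟩
    calc ‖z - (s : ℂ)‖ ≤ |z.re - s| + |z.im| := hn
      _ < η + η := by linarith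
      _ = C⁻¹ := by rw [hη]; ring
  exact hD G hG r s C hC L t (ht t htt s hsc hs2 ·) z hdist

end Summit.QuantumFields.YangMills.Cruxes.TubeZeroFreeChannel.Strategist
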